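import Summits.HodgeConjecture.CorCM.HypLiu418.A3Liu418PinBettiPinningOfLemma24Proj
import Literature.NumberTheory.Automorphic.Liu2021.Lemma24OfJacobianDimension
import HarnessLib

/-!
# Line `a3_liu418`, residual `stub_S34`, clause (1): the face's Betti pinning along `τ′ = conj ∘ ι₁` at the EXPLICIT carrier `(C₄, T₄)`

Cell `hodgecm-mathlib` (D-0151), fan A, crux `HLiu418` (stmt-HodgeConjecture-24832), GS programme node (7-main), TARGET half, companion of
`Theorems/A3Liu418S34ClauseOneTarget.lean` (whose head `Model.exists_identityPiece_detectingFrame_of_omegaHom_ne_zero` takes a Betti pinning `B` of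
`C₄ := Model.sec42DataOfFourLe h V Φ h4 iso` along `T₄ := sec42DataOfFourLe_heckeTranslates hU7 h V Φ h4 iso` and `τ′ := conj ∘ ι₁` as a HYPOTHESIS).
THEOREMS ONLY: no definition, no instance, no named fact, no `sorry`.  HC_CM is NOT proved by this file (proved only modulo the 7 printed citations).

★ `pinBettiPinning_of_lemma24Proj hLp` (GAP 1 of the line from the PROJECTIVE form (Lp) of [Liu2021] Lem. 2.4 (1)) inhabits
`∃ τ′, Nonempty ((CV …).BettiPinning (TV …) τ′ PIN.H (Representation.ofModule' _))` at every face, with the witness `τ′ := conj ∘ ι₁` hidden under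
the `∃`; (Lp) itself is the tree's THEOREM ★ `albanese_bettiOne_pullback_bijective_of_isProjectiveOver` ((G)-road, `Liu2021/Lemma24OfJacobianDimension.lean`).
Here the same term is run with `τ′` EXPLICIT (the geometric-pin instance `algebraMap F ℂ := conj ∘ ι₁`, as in ★ `pinBettiPinning_of_lemma24`) and the
pinning is moved from the total carrier `(CV, TV)` to the explicit one `(C₄, T₄)` by ★ `bettiPinning_transport_eq` along ★ `sec42DataOf_eq_of_four_le` /
★ `sec42DataOf_heckeTranslates_heq`:

* `nonempty_bettiPinning_conj_fourLe_of_lemma24Proj` — for every face `(hDel, F, h6, ι₁, V, a, Φ)`: a module `H` with a `ℂ[𝔾(𝔸_F^∞)]`-action and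
  `Nonempty (C₄.BettiPinning T₄ (conj ∘ ι₁) H rhoB)` — UNCONDITIONALLY in the tree's facts (the only named fact is `hDel`, the face's own binder
  [Deligne1979ShimuraVarieties] 2.2.5; the Hecke translates are the `_holds`-fed `heckeTranslate_definedOver_holds`).

References: [Liu2021] Y. Liu, arXiv:2102.11518 = Camb. J. Math. 9 (2021): §4.2 (FJcycle.tex l. 2062–2081), Lem. 2.4 (1) (l. 1210–1228), Thm. 4.15 proof
(l. 2199–2213); [Deligne1979ShimuraVarieties] 2.1.2–2.1.4, 2.2.5; [Arapura2012] Cor. 15.4.6.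
-/

set_option autoImplicit false

noncomputable section

namespace Summit.HodgeConjecture.CorCM.Lines.A3Liu418

open CategoryTheory CategoryTheory.Limits AlgebraicGeometry MonoidalCategory CartesianMonoidalCategory
open Literature.AlgebraicGeometry.Motives
open AbelianVariety (bcFunctor)
open scoped TensorProduct Matrix
open NumberField NumberField.InfinitePlace
open HodgeCM.Model HodgeCM.Model.LiuIndex HodgeCM.Model.TowerCarrier
open Summit.HodgeConjecture.CorCM.Model
open Literature.AlgebraicGeometry.Motives (CMType)
open Literature.AlgebraicGeometry.HodgeTheory Literature.NumberTheory.Automorphic.PicardCM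
open Literature.AlgebraicGeometry.ShimuraVarieties.UnitaryCanonicalModel
open Literature.NumberTheory.ComplexMultiplication
open Literature.NumberTheory.Automorphic
open Literature.NumberTheory.Automorphic.Liu2021 Literature.NumberTheory.Automorphic.Liu2021.AppendixC
open Literature.NumberTheory.Automorphic.Liu2021.AppendixC.RestOne
open Summit.HodgeConjecture.CorCM.Transposition.OmegaTransport (realUnit)
open Literature.RepresentationTheory Literature.RepresentationTheory.Liu2021
open Summit.HodgeConjecture.CorCM.Transposition
open Summit.HodgeConjecture.CorCM.D2Bridge
open Summit.HodgeConjecture.CorCM.D2Bridge.MuKeyIdentLemD3End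
open Summit.HodgeConjecture.CorCM.D2Bridge.MuKeyIdentLemD3DelRecConjOmegaEndT

set_option synthInstance.maxHeartbeats 400000 in
set_option maxHeartbeats 4000000 in
/-- **The face's Betti pinning along `τ′ = conj ∘ ι₁`, at the EXPLICIT carrier `(C₄, T₄)`.**  At every face `(hDel, F, ι₁, V, a, Φ)` with `6 ≤ [F:ℚ]` the
PIN's tower module `(liuDictionaryPin ⋯ V I line).H` with its natural `ℂ[𝔾(𝔸_F^∞)]`-action is pinned to the Albanese Betti levels `H¹_{B,τ′}(A_K, ℂ)` of
`C₄ := sec42DataOfFourLe h ⟨Hm V,…⟩ Φ h4 (isoOf …)` along `T₄ := sec42DataOfFourLe_heckeTranslates heckeTranslate_definedOver_holds h ⟨Hm V,…⟩ Φ h4 (isoOf …)`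
and `τ′ := conj ∘ ι₁`: the term of ★ `pinBettiPinning_of_lemma24Proj` (★ `nonempty_bettiPinning_of_componentAlbanese` at `componentAlbanesePinTotal`,
bijectivity ★ `LevelQReps.bijective_albStarQ_componentAlbanesePinTotal_of_lemma24Proj` fed by the THEOREM ★
`albanese_bettiOne_pullback_bijective_of_isProjectiveOver`) under the instance `algebraMap F ℂ := conj ∘ ι₁`, then ★ `bettiPinning_transport_eq`
along ★ `sec42DataOf_eq_of_four_le` / ★ `sec42DataOf_heckeTranslates_heq`.  Feeds the binder `B` of `Model.exists_identityPiece_detectingFrame_of_omegaHom_ne_zero`.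
[cite: Liu2021, §4.2 l. 2074–2081; Lem. 2.4 (1) l. 1210–1228; Thm. 4.15 proof l. 2199–2213] [cite: Deligne1979ShimuraVarieties, 2.1.2–2.1.4 and 2.2.5]
[cite: Arapura2012, Cor. 15.4.6] -/
theorem nonempty_bettiPinning_conj_fourLe_of_lemma24Proj
    (hDel : Literature.AlgebraicGeometry.ShimuraVarieties.UnitaryCanonicalModel.canonicalModel_exists_printed)
    (F : HodgeCM.CMField) [IsGalois ℚ F] (h6 : 6 ≤ Module.finrank ℚ F) {ι₁ : F →+* ℂ} (V : HodgeCM.HermSpace3 F ι₁) (a : RealScalar F)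
    (Φ : CMType F) :
    Nonempty ((sec42DataOfFourLe (Summit.HodgeConjecture.CorCM.DelRec.exists_recordSystem_of_printed hDel)
        (⟨HodgeCM.HermSpace3.Hm V, HodgeCM.HermSpace3.isHermitian V, HodgeCM.HermSpace3.signature_ι₁ V, HodgeCM.HermSpace3.posDef_of_ne V⟩ :
          HermSpace3 ⟨HodgeCM.CMField.K F⟩ ι₁) Φ (le_trans (by norm_num) h6)
        (isoOf ⟨HodgeCM.CMField.K F⟩ ι₁ ⟨HodgeCM.HermSpace3.Hm V, HodgeCM.HermSpace3.isHermitian V, HodgeCM.HermSpace3.signature_ι₁ V,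
          HodgeCM.HermSpace3.posDef_of_ne V⟩ Φ)).BettiPinning
      (sec42DataOfFourLe_heckeTranslates heckeTranslate_definedOver_holds (Summit.HodgeConjecture.CorCM.DelRec.exists_recordSystem_of_printed hDel)
        (⟨HodgeCM.HermSpace3.Hm V, HodgeCM.HermSpace3.isHermitian V, HodgeCM.HermSpace3.signature_ι₁ V, HodgeCM.HermSpace3.posDef_of_ne V⟩ :
          HermSpace3 ⟨HodgeCM.CMField.K F⟩ ι₁) Φ (le_trans (by norm_num) h6)
        (isoOf ⟨HodgeCM.CMField.K F⟩ ι₁ ⟨HodgeCM.HermSpace3.Hm V, HodgeCM.HermSpace3.isHermitian V, HodgeCM.HermSpace3.signature_ι₁ V,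
          HodgeCM.HermSpace3.posDef_of_ne V⟩ Φ))
      ((starRingEnd ℂ).comp ι₁)
      ((liuDictionaryPin exists_isReal_hodgeModel_holds hodgePQ_independent_of_hodgeModel_holds BallQuotient.ballQuotientUniformised_holds
          (cmAbelianVarietyRealised_of_eigenbasis exists_isReal_hodgeModel_holds hodgePQ_independent_of_hodgeModel_holds
            cmAbelianVarietyEigenbasisRealised_holds)
          Literature.NumberTheory.Transcendental.arapura2012_cor_15_4_6_holds V (I V (repAt a) (muLiu ι₁ GramClass.rep))
          (line V (repAt a) (muLiu ι₁ GramClass.rep))).H)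
      (Representation.ofModule' _)) := by
  -- the geometric-pin instance `algebraMap F ℂ := ῑ₁ = conj ∘ ι₁`, under which `algebraMap ∘ c = ι₁`
  letI : Algebra (F : Type) ℂ := ((starRingEnd ℂ).comp ι₁).toAlgebra
  have hinst : ∀ x : F, algebraMap (F : Type) ℂ x = ((starRingEnd ℂ).comp ι₁) x := fun _ => rfl
  have hι : (algebraMap (F : Type) ℂ).comp (cmConjRingHom F) = ι₁ := by
    ext x
    rw [RingHom.coe_comp, Function.comp_apply, hinst, embedding_cmConjRingHom, RingHom.coe_comp, Function.comp_apply,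
      starRingEnd_self_apply]
  have h4 : 4 ≤ Module.finrank ℚ F := le_trans (by norm_num) h6
  -- the pinning of the TOTAL carrier `(CV, TV)` along `algebraMap F ℂ = conj ∘ ι₁` (the term of ★ `pinBettiPinning_of_lemma24Proj`)
  have B₀ : Nonempty ((sec42DataOf (Summit.HodgeConjecture.CorCM.DelRec.exists_recordSystem_of_printed hDel) isoOf
        ⟨HodgeCM.CMField.K F⟩ ι₁ ⟨HodgeCM.HermSpace3.Hm V, HodgeCM.HermSpace3.isHermitian V, HodgeCM.HermSpace3.signature_ι₁ V,
          HodgeCM.HermSpace3.posDef_of_ne V⟩ Φ).BettiPinning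
        (heckeTranslatesFamilyOf heckeTranslate_definedOver_holds (Summit.HodgeConjecture.CorCM.DelRec.exists_recordSystem_of_printed hDel)
          isoOf ⟨HodgeCM.CMField.K F⟩ ι₁ ⟨HodgeCM.HermSpace3.Hm V, HodgeCM.HermSpace3.isHermitian V, HodgeCM.HermSpace3.signature_ι₁ V,
            HodgeCM.HermSpace3.posDef_of_ne V⟩ Φ h6)
        (algebraMap (F : Type) ℂ)
        ((liuDictionaryPin exists_isReal_hodgeModel_holds hodgePQ_independent_of_hodgeModel_holds BallQuotient.ballQuotientUniformised_holds
            (cmAbelianVarietyRealised_of_eigenbasis exists_isReal_hodgeModel_holds hodgePQ_independent_of_hodgeModel_holds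
              cmAbelianVarietyEigenbasisRealised_holds)
            Literature.NumberTheory.Transcendental.arapura2012_cor_15_4_6_holds V (I V (repAt a) (muLiu ι₁ GramClass.rep))
            (line V (repAt a) (muLiu ι₁ GramClass.rep))).H)
        (Representation.ofModule' _)) :=
    nonempty_bettiPinning_of_componentAlbanese exists_isReal_hodgeModel_holds hodgePQ_independent_of_hodgeModel_holds
      (ballQuotientUniformisedDatum_of BallQuotient.ballQuotientUniformised_holds)
      (cmAbelianVarietyRealised_of_eigenbasis exists_isReal_hodgeModel_holds hodgePQ_independent_of_hodgeModel_holds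
        cmAbelianVarietyEigenbasisRealised_holds)
      Literature.NumberTheory.Transcendental.arapura2012_cor_15_4_6_holds V
      (Summit.HodgeConjecture.CorCM.DelRec.exists_recordSystem_of_printed hDel) Φ _ _ h4
      (componentAlbanesePinTotal exists_isReal_hodgeModel_holds hodgePQ_independent_of_hodgeModel_holds
        (ballQuotientUniformisedDatum_of BallQuotient.ballQuotientUniformised_holds)
        (cmAbelianVarietyRealised_of_eigenbasis exists_isReal_hodgeModel_holds hodgePQ_independent_of_hodgeModel_holds
          cmAbelianVarietyEigenbasisRealised_holds)
        Literature.NumberTheory.Transcendental.arapura2012_cor_15_4_6_holds heckeTranslate_definedOver_holds V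
        (Summit.HodgeConjecture.CorCM.DelRec.exists_recordSystem_of_printed hDel) h4 hι Φ isoOf)
      (componentAlbanesePinTotal_levelLaw exists_isReal_hodgeModel_holds hodgePQ_independent_of_hodgeModel_holds
        (ballQuotientUniformisedDatum_of BallQuotient.ballQuotientUniformised_holds)
        (cmAbelianVarietyRealised_of_eigenbasis exists_isReal_hodgeModel_holds hodgePQ_independent_of_hodgeModel_holds
          cmAbelianVarietyEigenbasisRealised_holds)
        Literature.NumberTheory.Transcendental.arapura2012_cor_15_4_6_holds heckeTranslate_definedOver_holds V
        (Summit.HodgeConjecture.CorCM.DelRec.exists_recordSystem_of_printed hDel) h4 hι Φ isoOf)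
      (LevelQReps.bijective_albStarQ_componentAlbanesePinTotal_of_lemma24Proj albanese_bettiOne_pullback_bijective_of_isProjectiveOver V
        (ballQuotientUniformisedDatum_of BallQuotient.ballQuotientUniformised_holds)
        (cmAbelianVarietyRealised_of_eigenbasis exists_isReal_hodgeModel_holds hodgePQ_independent_of_hodgeModel_holds
          cmAbelianVarietyEigenbasisRealised_holds)
        h4 (Summit.HodgeConjecture.CorCM.DelRec.exists_recordSystem_of_printed hDel) exists_isReal_hodgeModel_holds hι
        hodgePQ_independent_of_hodgeModel_holds Literature.NumberTheory.Transcendental.arapura2012_cor_15_4_6_holds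
        heckeTranslate_definedOver_holds Φ isoOf)
  -- move it to the EXPLICIT carrier `(C₄, T₄)` (`CV = C₄` by `dif_pos`, translates by `cast`)
  exact bettiPinning_transport_eq
    (sec42DataOf_eq_of_four_le (Summit.HodgeConjecture.CorCM.DelRec.exists_recordSystem_of_printed hDel)
      (⟨HodgeCM.HermSpace3.Hm V, HodgeCM.HermSpace3.isHermitian V, HodgeCM.HermSpace3.signature_ι₁ V, HodgeCM.HermSpace3.posDef_of_ne V⟩ :
        HermSpace3 ⟨HodgeCM.CMField.K F⟩ ι₁) Φ isoOf h4).symm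
    (sec42DataOf_heckeTranslates_heq heckeTranslate_definedOver_holds (Summit.HodgeConjecture.CorCM.DelRec.exists_recordSystem_of_printed hDel)
      (⟨HodgeCM.HermSpace3.Hm V, HodgeCM.HermSpace3.isHermitian V, HodgeCM.HermSpace3.signature_ι₁ V, HodgeCM.HermSpace3.posDef_of_ne V⟩ :
        HermSpace3 ⟨HodgeCM.CMField.K F⟩ ι₁) Φ isoOf h4).symm
    B₀

end Summit.HodgeConjecture.CorCM.Lines.A3Liu418

end
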